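import Summits.ResolutionOfSingularities.ResolutionOfSingularities.Theorems.FrobeniusClosingSteerStrippedChainParityQT
import Mathlib.RingTheory.Length
import HarnessLib

/-!
# Crux `Steer` (stmt-ResolutionOfSingularities-16345), chain W4.1, hG3 RUNG (`NoEternalConstOrderIsolatedChainPerfect 2 3 d`):
# the ASSEMBLY of THEOREM-G3PERF — G-perf(3, d) from three named one-step inputs (node, siblings, finiteness)

OURS (campaign `res-hironaka`, rung L ★L-G4, slot W4.1; seat res-L0-w41-stub-2 g5). Word of record: r38/r39 `NoEternalConstOrderIsolatedChainPerfect p c d`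
(p = 2, c = 3, d = 2e ≥ 4). The by-hand proof (THEOREM-G3PERF.md 35f65652b27c875b, tri-2 audit 83a2b6bb04b15bef PASS) has, per step S ≤ S′ of the chain:
(3) CONE — constant cleaned order forces the initial form of the member to be a binary form in a regular system of parameters two of which vanish at the
next centre; (4) SIBLINGS — then every other quadratic transform of S carries a transform with isolated (or no) singularity; (5) NODE — the Milnor-type
length μ := ℓ(S ⧸ 𝒥_abs(f)) drops by at least c₃(d) = d³ − 2d² + 2 (intersection theory on the point blow-up; OUR hypothesis-node `MilnorDropPointBlowup`,
not in print, not in Mathlib); (6) assembly. THIS FILE (sorry-free): the one-step binder block `ConstOrderStep`, the frame-free Milnor-type length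
`milnorLength S f := ℓ(S ⧸ span{D f : D ∈ Der_ℤ(S)})`, the three named inputs as Props — `MilnorDropPointBlowup d` (OUR hypothesis-node, CANDIDATE),
`SiblingsIsolated d` (step (4), by-hand proved, kernel pending), `MilnorFinite d` (excellence + Jacobian criterion, kernel pending) — and the PROVED
assembly `noEternalConstOrderIsolatedChainPerfect_two_three : node → siblings → finiteness → (binders of the r38/r39 word, `HasCleaningDerivations`
omitted as unused) → False`. The sorried signatures of (3)/(4)/finiteness live in the sketch `HOME/L/res-L0-w41-stub-2/G3PerfSketch.lean`.
Absolute derivations `Derivation ℤ S S` are the chain's currency (`HasCleaningDerivations`); over a perfect residue field they give the Jacobian ideal of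
the completion's canonical frame (res-L0-w41-tri-2 audit 83a2b6bb04b15bef, (B10)). replaces the role of no printed item; NOT a statement of the manuscript
under review; AI-produced, weaker than expert review. [folklore]
-/

noncomputable section

set_option linter.dupNamespace false

open Polynomial IsLocalRing Literature.AlgebraicGeometry.Resolution

namespace Summit.ResolutionOfSingularities.ResolutionOfSingularities.Theorems.SwitchingDichotomy.G3Perf

universe u

/-- The ABSOLUTE Jacobian ideal of `f`: the ideal generated by all values `D f`, `D` an (absolute) derivation of `S`. OURS. [folklore] -/
def jacobianIdealAbs (S : Type u) [CommRing S] (f : S) : Ideal S :=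
  Ideal.span (Set.range fun D : Derivation ℤ S S => D f)

/-- The MILNOR-TYPE LENGTH `μ(S, f) := ℓ_S (S ⧸ 𝒥_abs(f)) ∈ ℕ∞` (finite iff `𝒥_abs(f)` is `𝔪`-primary; cleaning-invariant since `D(h²) = 2hDh = 0`
in characteristic 2). OURS. [folklore] -/
def milnorLength (S : Type u) [CommRing S] (f : S) : ℕ∞ :=
  Module.length S (S ⧸ jacobianIdealAbs S f)

/-- Isolatedness binder of the chain words, spelled Theses-free (= `HasIsolatedSingularity (RadicandRing S p f)`). -/
def IsolatedRadicand (p : ℕ) (S : Type u) [CommRing S] (f : S) : Prop :=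
  ∀ (Q : Ideal (AdjoinRoot ((X : S[X]) ^ p - C f))) [Q.IsPrime],
    (∃ Q' : Ideal (AdjoinRoot ((X : S[X]) ^ p - C f)), Q'.IsPrime ∧ Q < Q') → IsRegularLocalRing (Localization.AtPrime Q)

variable {L : Type} [Field L] [CharP L 2]

/-- ONE STEP of a constant-order isolated chain at `(p, c, d) = (2, 3, d)` with perfect residue fields: the common binder block of (3)–(5),
cut from `NoEternalConstOrderIsolatedChainPerfect 2 3 d` at stages `m`, `m+1` (`S = S m`, `S' = S (m+1)`, `x = x m`, `f = f m`, `g = g m`, `f' = f (m+1)`).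
OURS. -/
structure ConstOrderStep (d : ℕ) (S S' : Subring L) [IsLocalRing S] [IsLocalRing S'] (hle : S ≤ S') (x : S') (f g : S) (f' : S') : Prop where
  reg : IsRegularLocalRing S
  reg' : IsRegularLocalRing S'
  exc : IsExcellentRing S
  exc' : IsExcellentRing S'
  dim : ringKrullDim S = (3 : ℕ)
  dim' : ringKrullDim S' = (3 : ℕ)
  qt : IsQuadraticTransform S S'
  span : Ideal.span ((fun y : S => (⟨(y : L), hle y.2⟩ : S')) '' (maximalIdeal S : Set S)) = Ideal.span {x}
  law : ((f' : S') : L) * ((x : S') : L) ^ d = ((f : S) : L) - ((g : S) : L) ^ 2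
  mult : ∃ h : S, f - h ^ 2 ∈ maximalIdeal S ^ 2
  opt : ∀ h : S, f - h ^ 2 ∉ maximalIdeal S ^ (d + 1)
  opt' : ∀ h : S', f' - h ^ 2 ∉ maximalIdeal S' ^ (d + 1)
  perf : PerfectField (ResidueField S)
  perf' : PerfectField (ResidueField S')
  isol : IsolatedRadicand 2 S f
  isol' : IsolatedRadicand 2 S' f'

variable (d : ℕ) {S S' : Subring L} [IsLocalRing S] [IsLocalRing S'] {hle : S ≤ S'} {x : S'} {f g : S} {f' : S'}

/-- **(5) NODE `MilnorDropPointBlowup 3 d`** (OUR hypothesis-node; intersection theory on `Bl_𝔪 Spec S`, char 2, `2 ∣ d`; THEOREM-G3PERF step 5 /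
G3-CENSUS (J6); tri-2 readout 9b3dd2bfb98a9c92; NOT in print, NOT in Mathlib): for one constant-order step whose siblings are all isolated (the conclusion
of (4)), `μ(S', f') + (d³ − 2d² + 2) ≤ μ(S, f)`. (The by-hand statement is the EQUALITY `Σ_R [κ(R):κ] μ_R = μ − (d³ − 2d² + 2)` over all closed points
`R` of the exceptional divisor; the chain needs only this inequality.) OURS, CANDIDATE. [folklore] -/
def MilnorDropPointBlowup (d : ℕ) : Prop :=
  ∀ (L : Type) [Field L] [CharP L 2] (S S' : Subring L) [IsLocalRing S] [IsLocalRing S'] (hle : S ≤ S') (x : S') (f g : S) (f' : S'),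
    ConstOrderStep d S S' hle x f g f' →
    (∀ (S'' : Subring L) [IsLocalRing S''] (hle'' : S ≤ S''), IsQuadraticTransform S S'' → ∀ x'' f'' : S'',
      Ideal.span ((fun y : S => (⟨(y : L), hle'' y.2⟩ : S'')) '' (maximalIdeal S : Set S)) = Ideal.span {x''} →
      ((f'' : S'') : L) * ((x'' : S'') : L) ^ d = ((f : S) : L) - ((g : S) : L) ^ 2 → IsolatedRadicand 2 S'' f'') →
    milnorLength S' f' + ((d ^ 3 - 2 * d ^ 2 + 2 : ℕ) : ℕ∞) ≤ milnorLength S f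

/-- Statement (4) as a Prop (all siblings of a constant-order isolated step are isolated). OURS. -/
def SiblingsIsolated (d : ℕ) : Prop :=
  ∀ (L : Type) [Field L] [CharP L 2] (S S' : Subring L) [IsLocalRing S] [IsLocalRing S'] (hle : S ≤ S') (x : S') (f g : S) (f' : S'),
    ConstOrderStep d S S' hle x f g f' →
    ∀ (S'' : Subring L) [IsLocalRing S''] (hle'' : S ≤ S''), IsQuadraticTransform S S'' → ∀ x'' f'' : S'',
      Ideal.span ((fun y : S => (⟨(y : L), hle'' y.2⟩ : S'')) '' (maximalIdeal S : Set S)) = Ideal.span {x''} →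
      ((f'' : S'') : L) * ((x'' : S'') : L) ^ d = ((f : S) : L) - ((g : S) : L) ^ 2 → IsolatedRadicand 2 S'' f''

/-- Finiteness of `μ` at the source of a constant-order isolated step, as a Prop. OURS. -/
def MilnorFinite (d : ℕ) : Prop :=
  ∀ (L : Type) [Field L] [CharP L 2] (S S' : Subring L) [IsLocalRing S] [IsLocalRing S'] (hle : S ≤ S') (x : S') (f g : S) (f' : S'),
    ConstOrderStep d S S' hle x f g f' → milnorLength S f < ⊤

/-- **(6) ASSEMBLY — PROVED modulo the three named inputs** (node (5), siblings (4), finiteness): along a constant-order isolated chain with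
perfect residue fields at `(2, 3, d)`, `μ(S m, f m) ∈ ℕ` would drop by `d³ − 2d² + 2 ≥ 2` at every step. The binder list is that of the r38/r39 word
`NoEternalConstOrderIsolatedChainPerfect 2 3 d` with `HasCleaningDerivations` omitted (unused). OURS. -/
theorem noEternalConstOrderIsolatedChainPerfect_two_three (hnode : MilnorDropPointBlowup d) (hsib : SiblingsIsolated d)
    (hfin : MilnorFinite d) :
    ∀ (S : ℕ → Subring L) [∀ m, IsLocalRing (S m)]
      (hle : ∀ m, S m ≤ S (m + 1)) (f g : ∀ m, S m) (x : ∀ m, S (m + 1)),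
      (∀ m, IsRegularLocalRing (S m)) → (∀ m, IsExcellentRing (S m)) → (∀ m, ringKrullDim (S m) = (3 : ℕ)) →
      (∀ m, IsQuadraticTransform (S m) (S (m + 1))) →
      (∀ m, Ideal.span ((fun y : S m => (⟨(y : L), hle m y.2⟩ : S (m + 1))) '' (maximalIdeal (S m) : Set (S m)))
          = Ideal.span {x m}) →
      (∀ m, ((f (m + 1) : S (m + 1)) : L) * ((x m : S (m + 1)) : L) ^ d =
          ((f m : S m) : L) - ((g m : S m) : L) ^ 2) →
      (∀ m, ∃ h : S m, f m - h ^ 2 ∈ maximalIdeal (S m) ^ 2) →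
      (∀ m (h : S m), f m - h ^ 2 ∉ maximalIdeal (S m) ^ (d + 1)) →
      (∀ m, PerfectField (ResidueField (S m))) →
      (∀ m, IsolatedRadicand 2 (S m) (f m)) →
      False := by
  intro S _ hle f g x hreg hexc hdim hQT hspan hrel hmult hopt hperf hisol
  have step : ∀ m, ConstOrderStep d (S m) (S (m + 1)) (hle m) (x m) (f m) (g m) (f (m + 1)) := fun m =>
    { reg := hreg m, reg' := hreg (m + 1), exc := hexc m, exc' := hexc (m + 1), dim := hdim m, dim' := hdim (m + 1), qt := hQT m,
      span := hspan m, law := hrel m, mult := hmult m, opt := hopt m, opt' := hopt (m + 1), perf := hperf m, perf' := hperf (m + 1),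
      isol := hisol m, isol' := hisol (m + 1) }
  set c : ℕ := d ^ 3 - 2 * d ^ 2 + 2 with hc
  have key : ∀ m, milnorLength (S (m + 1)) (f (m + 1)) + (c : ℕ∞) ≤ milnorLength (S m) (f m) := fun m =>
    hnode L (S m) (S (m + 1)) (hle m) (x m) (f m) (g m) (f (m + 1)) (step m)
      (fun S'' _ hle'' hQT'' x'' f'' hspan'' hlaw'' => hsib L (S m) (S (m + 1)) (hle m) (x m) (f m) (g m) (f (m + 1)) (step m)
        S'' hle'' hQT'' x'' f'' hspan'' hlaw'')
  have fin : ∀ m, milnorLength (S m) (f m) < ⊤ := fun m => hfin L (S m) (S (m + 1)) (hle m) (x m) (f m) (g m) (f (m + 1)) (step m)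
  -- pass to ℕ
  have hn : ∀ m, ((milnorLength (S m) (f m)).toNat : ℕ∞) = milnorLength (S m) (f m) := fun m => ENat.coe_toNat (fin m).ne
  have dec : ∀ m, (milnorLength (S (m + 1)) (f (m + 1))).toNat + c ≤ (milnorLength (S m) (f m)).toNat := by
    intro m
    have h := key m
    rw [← hn (m + 1), ← hn m] at h
    exact_mod_cast h
  have hc2 : 2 ≤ c := by rw [hc]; exact Nat.le_add_left 2 _
  have bound : ∀ m, (milnorLength (S m) (f m)).toNat + 2 * m ≤ (milnorLength (S 0) (f 0)).toNat := by
    intro m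
    induction m with
    | zero => simp
    | succ k ih => have := dec k; omega
  have := bound ((milnorLength (S 0) (f 0)).toNat + 1)
  omega

end Summit.ResolutionOfSingularities.ResolutionOfSingularities.Theorems.SwitchingDichotomy.G3Perf

end
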